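import Mathlib
import HarnessLib
import Summits.ValiantsHypothesis.ValiantsHypothesis.Theorems.LacunarySymmetroidMatrixDescartesProductPlusOneCoherentK
import Summits.ValiantsHypothesis.ValiantsHypothesis.Theorems.LacunarySymmetroidMatrixDescartesProductPlusOneMixedSigned

/-!
# ValiantsHypothesis / LacunarySymmetroid — crux `MatrixDescartes` (stmt-ValiantsHypothesis-18050, V1),
# LINE (A) «product_plus_one»: the COHERENT ONE-ZERO SECTOR, EVERY `K` — MEMBERS, SIGN-AWARE: `Z₊ ≤ m + 2`

val-lit-p5 g13's ✓ `…ProductPlusOneCoherentK` proves that for COHERENT factors (single sign change, at the top letter) the weighted level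
function `Ξ_j = (X f_j′ − d_0 f_j)/(x^w f_j)`, `w = d_{T−1} − d_0`, has a negative derivative (`hasDerivAt_coherentXi_neg`), whence the
c-free Euler bound `2m + 1`.  Here the MEMBER count is drawn SIGN-AWARE with the gap-parity lemma (✓ `card_pos_roots_le_countP_add_two`,
`…MixedSigned`): a coherent factor has exactly one positive zero counted WITH multiplicity (`coherent_countP_pos_roots_le_one`, Descartes
`V = 1`), three member zeros in a zero-free interval of `P` are impossible (Rolle for `θ_{m d_0}` + `Σ_j Ξ_j` strictly decreasing), so
`coherentK_sector_pos_roots_signed`: `Z₊(κ X^{m d_0} + ∏_j f_j) ≤ m + 2`, and in the line's shape `coherent_sector_classK_signed`: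
EVERY format `K ≥ 3`, every strictly increasing support, bottom coupling, all factors coherent ⇒ `Z₊ ≤ m + 2` (for K = 3 this is p5's
`…TameSigned` constant on the coherent sub-sector, now at every ratio).

HONEST FRAMING: a sector constant; NOT `stub_classRowK3`, not `stub_polyLaw`, not `ProductPlusOneMDR`, not `MatrixDescartes`, not Conjecture B;
`VP ≠ VNP` is NOT proved.  No definitions, no named facts.  Certificate = p5 g13's `…CoherentK` / `…CoherentCopositivity`.
-/

-- `Summit.ValiantsHypothesis.ValiantsHypothesis.…` is the tree's mandated single-conjunct layout (Sub = Summit).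
set_option linter.dupNamespace false

namespace Summit.ValiantsHypothesis.ValiantsHypothesis.Theorems.LacunarySymmetroidMatrixDescartes

namespace ProductPlusOne

open Polynomial Finset
open scoped BigOperators

/-- A COHERENT sparse factor (`c_0 c_i > 0` for `i < T`, `c_0 c_T < 0`) has at most ONE positive zero counted with multiplicity
(Descartes: one sign variation). [folklore] -/
theorem coherent_countP_pos_roots_le_one (T : ℕ) (d : ℕ → ℕ) (hd : StrictMono d) (c : ℕ → ℝ)
    (hcoh : ∀ i, i < T → 0 < c 0 * c i) (htop : c 0 * c T < 0) :
    (∑ i ∈ Finset.range (T + 1), C (c i) * X ^ (d i) : ℝ[X]).roots.countP (fun t => 0 < t) ≤ 1 := by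
  classical
  -- sign-normalised statement: c i > 0 for i < T, c T < 0
  have key : ∀ c' : ℕ → ℝ, (∀ i, i < T → 0 < c' i) → c' T < 0 →
      (∑ i ∈ Finset.range (T + 1), C (c' i) * X ^ (d i) : ℝ[X]).roots.countP (fun t => 0 < t) ≤ 1 := by
    intro c' hpos hneg
    refine (roots_countP_pos_le_signVariations _).trans ?_
    refine signVariations_le_one_of_top _ (d T) (fun k hk => ?_) (fun k hk => ?_)
    · rw [finsetSum_coeff]
      refine Finset.sum_nonneg (fun i hi => ?_)
      rw [coeff_C_mul_X_pow]
      split_ifs with h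
      · have hiT : i < T := by
          rcases Nat.lt_or_ge i T with h' | h'
          · exact h'
          · exfalso
            have : i = T := by have := Finset.mem_range.mp hi; omega
            exact hk (by rw [h, this])
        have := hpos i hiT
        linarith
      · exact le_rfl
    · rw [finsetSum_coeff]
      refine Finset.sum_eq_zero (fun i hi => ?_)
      rw [coeff_C_mul_X_pow, if_neg]
      intro h
      have hle : d i ≤ d T := hd.monotone (by have := Finset.mem_range.mp hi; omega)
      omega
  rcases lt_or_gt_of_ne (show c 0 ≠ 0 from fun h => by rw [h, zero_mul] at htop; exact lt_irrefl 0 htop) with h0 | h0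
  · -- c 0 < 0: the coefficients -c are normalised
    have hpos : ∀ i, i < T → 0 < -c i := by
      intro i hi; have := hcoh i hi; nlinarith
    have hneg : -c T < 0 := by nlinarith
    have e1 : (∑ i ∈ Finset.range (T + 1), C (c i) * X ^ (d i) : ℝ[X])
        = -(∑ i ∈ Finset.range (T + 1), C ((fun i => -c i) i) * X ^ (d i)) := by
      rw [← Finset.sum_neg_distrib]
      refine Finset.sum_congr rfl (fun i _ => ?_)
      simp only [map_neg, neg_mul, neg_neg]
    rw [e1, roots_neg]
    exact key (fun i => -c i) hpos hneg
  · have hpos : ∀ i, i < T → 0 < c i := by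
      intro i hi; have := hcoh i hi; nlinarith
    have hneg : c T < 0 := by nlinarith
    exact key c hpos hneg

/-- **THE COHERENT ONE-ZERO SECTOR, EVERY NUMBER OF TERMS, SIGN-AWARE**: `m` coherent `(T+1)`-nomials on a common strictly increasing
support (`T ≥ 2`), bottom coupling `N = m·d_0`: `Z₊(κ X^{m d_0} + ∏_j f_j) ≤ m + 2`. [this file's theorem] -/
theorem coherentK_sector_pos_roots_signed {m : ℕ} (T : ℕ) (hT : 2 ≤ T) (d : ℕ → ℕ) (hd : StrictMono d) (c : Fin m → ℕ → ℝ)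
    (hcoh : ∀ j i, i < T → 0 < c j 0 * c j i) (htop : ∀ j, c j 0 * c j T < 0) (κ : ℝ) :
    ((C κ * X ^ (m * d 0) + ∏ j, (∑ i ∈ Finset.range (T + 1), C (c j i) * X ^ (d i) : ℝ[X])).roots.toFinset.filter
      (fun t => 0 < t)).card ≤ m + 2 := by
  classical
  set P : ℝ[X] := ∏ j, (∑ i ∈ Finset.range (T + 1), C (c j i) * X ^ (d i) : ℝ[X]) with hPdef
  rcases Nat.eq_zero_or_pos m with hm | hm
  · subst hm
    have hP1 : P = 1 := by rw [hPdef]; exact Fintype.prod_empty _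
    rw [hP1, zero_mul, pow_zero, mul_one, ← C_1, ← C_add]
    by_cases h0 : κ + 1 = 0
    · rw [h0, map_zero, roots_zero]; simp
    · rw [roots_C]; simp
  obtain ⟨hP0, _⟩ := prod_coherent_pos_roots_le T (by omega) d hd c hcoh htop
  -- multiplicity of the positive zeros of P: ≤ m
  have hmult : P.roots.countP (fun t => 0 < t) ≤ m := by
    have hne : ∀ j, (∑ i ∈ Finset.range (T + 1), C (c j i) * X ^ (d i) : ℝ[X]) ≠ 0 := by
      intro j h
      apply hP0
      exact Finset.prod_eq_zero (Finset.mem_univ j) h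
    have key : ∀ s : Finset (Fin m),
        (∏ j ∈ s, (∑ i ∈ Finset.range (T + 1), C (c j i) * X ^ (d i) : ℝ[X])).roots.countP (fun t => 0 < t) ≤ s.card := by
      intro s
      induction s using Finset.induction_on with
      | empty => simp
      | @insert a s ha ih =>
        rw [Finset.prod_insert ha, roots_mul (mul_ne_zero (hne a) (Finset.prod_ne_zero_iff.mpr (fun j _ => hne j))),
          Multiset.countP_add, Finset.card_insert_of_notMem ha]
        have h1 := coherent_countP_pos_roots_le_one T d hd (c a) (hcoh a) (htop a)
        omega
    have := key Finset.univ
    rwa [Finset.card_univ, Fintype.card_fin] at this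
  by_cases hκ : κ = 0
  · subst hκ
    rw [map_zero, zero_mul, zero_add]
    exact ((StubVLawTwo.card_filter_pos_le_countP P).trans hmult).trans (by omega)
  have hmain := card_pos_roots_le_countP_add_two P hP0 κ hκ (m * d 0) ?_
  · exact hmain.trans (by omega)
  -- no three member zeros in a zero-free interval of P
  intro z₁ hz₁ z₂ hz₂ z₃ hz₃ h12 h23 free13
  have hSmem : ∀ z ∈ (C κ * X ^ (m * d 0) + P).roots.toFinset.filter (fun t => 0 < t),
      0 < z ∧ eval z (C κ * X ^ (m * d 0) + P) = 0 := by
    intro z hz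
    rw [mem_filter, Multiset.mem_toFinset] at hz
    by_cases h0 : C κ * X ^ (m * d 0) + P = 0
    · rw [h0, roots_zero] at hz
      exact absurd hz.1 (Multiset.notMem_zero _)
    · exact ⟨hz.2, (IsRoot.def).mp ((mem_roots h0).mp hz.1)⟩
  have hfacne : ∀ t, eval t P ≠ 0 → ∀ j, (∑ i ∈ Finset.range (T + 1), C (c j i) * X ^ (d i) : ℝ[X]).eval t ≠ 0 := by
    intro t ht j hj
    apply ht
    rw [hPdef, eval_prod, Finset.prod_eq_zero_iff]
    exact ⟨j, mem_univ _, hj⟩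
  have hz₁pos := (hSmem z₁ hz₁).1
  obtain ⟨w₁, hw₁, hd₁⟩ := exists_root_euler_between (C κ * X ^ (m * d 0) + P) (m * d 0) hz₁pos h12 (hSmem z₁ hz₁).2 (hSmem z₂ hz₂).2
  obtain ⟨w₂, hw₂, hd₂⟩ := exists_root_euler_between (C κ * X ^ (m * d 0) + P) (m * d 0) (hz₁pos.trans h12) h23
    (hSmem z₂ hz₂).2 (hSmem z₃ hz₃).2
  have hw₁pos : 0 < w₁ := hz₁pos.trans hw₁.1
  have hw₁₂ : w₁ < w₂ := hw₁.2.trans hw₂.1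
  have hIcc : Set.Icc w₁ w₂ ⊆ Set.Icc z₁ z₃ := fun t ht => ⟨hw₁.1.le.trans ht.1, ht.2.trans hw₂.2.le⟩
  have hfree : ∀ t ∈ Set.Icc w₁ w₂, ∀ j, (∑ i ∈ Finset.range (T + 1), C (c j i) * X ^ (d i) : ℝ[X]).eval t ≠ 0 :=
    fun t ht j => hfacne t (free13 t (hIcc ht)) j
  -- level condition at a zero of X h′ − N h off the zeros of P
  have hlevelΦ : ∀ w : ℝ, 0 < w → eval w P ≠ 0 →
      eval w (X * derivative (C κ * X ^ (m * d 0) + P) - C ((m * d 0 : ℕ) : ℝ) * (C κ * X ^ (m * d 0) + P)) = 0 →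
      (∑ j, w * (derivative (∑ i ∈ Finset.range (T + 1), C (c j i) * X ^ (d i) : ℝ[X])).eval w
          / (∑ i ∈ Finset.range (T + 1), C (c j i) * X ^ (d i) : ℝ[X]).eval w) = (m : ℝ) * (d 0 : ℝ) := by
    intro w hw hPw hd0
    have hE : X * derivative (C κ * X ^ (m * d 0) + P) - C ((m * d 0 : ℕ) : ℝ) * (C κ * X ^ (m * d 0) + P)
        = X * derivative P - C ((m * d 0 : ℕ) : ℝ) * P := by
      have h := euler_sub_monomial P (-κ) (m * d 0)
      rw [map_neg] at h
      rw [show C κ * X ^ (m * d 0) + P = P - -C κ * X ^ (m * d 0) by ring]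
      exact h
    rw [hE, eval_sub, eval_mul, eval_X, eval_mul, eval_C, hPdef,
      eval_euler_prod_general _ (hfacne w hPw), ← eval_prod] at hd0
    rw [hPdef] at hPw
    have : eval w (∏ j, (∑ i ∈ Finset.range (T + 1), C (c j i) * X ^ (d i) : ℝ[X])) *
        ((∑ j, w * (derivative (∑ i ∈ Finset.range (T + 1), C (c j i) * X ^ (d i) : ℝ[X])).eval w
          / (∑ i ∈ Finset.range (T + 1), C (c j i) * X ^ (d i) : ℝ[X]).eval w) - (m : ℝ) * (d 0 : ℝ)) = 0 := by
      rw [mul_sub]; push_cast at hd0; linarith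
    rcases mul_eq_zero.mp this with h1 | h1
    · exact absurd h1 hPw
    · linarith
  have h1 := hlevelΦ w₁ hw₁pos (free13 w₁ (hIcc ⟨le_rfl, hw₁₂.le⟩)) hd₁
  have h2 := hlevelΦ w₂ (hw₁pos.trans hw₁₂) (free13 w₂ (hIcc ⟨hw₁₂.le, le_rfl⟩)) hd₂
  -- p5 g13's weighted level function Ξ and Rolle
  set Ξ : ℝ → ℝ := fun y => ∑ j, (X * derivative (∑ i ∈ Finset.range (T + 1), C (c j i) * X ^ (d i) : ℝ[X])
      - C ((d 0 : ℕ) : ℝ) * ∑ i ∈ Finset.range (T + 1), C (c j i) * X ^ (d i)).eval y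
      / (y ^ (d (T - 1) - d 0) * (∑ i ∈ Finset.range (T + 1), C (c j i) * X ^ (d i) : ℝ[X]).eval y) with hΞ
  have hlevel : ∀ y : ℝ, 0 < y → (∀ j, (∑ i ∈ Finset.range (T + 1), C (c j i) * X ^ (d i) : ℝ[X]).eval y ≠ 0) →
      (∑ j, y * (derivative (∑ i ∈ Finset.range (T + 1), C (c j i) * X ^ (d i) : ℝ[X])).eval y
          / (∑ i ∈ Finset.range (T + 1), C (c j i) * X ^ (d i) : ℝ[X]).eval y) = (m : ℝ) * (d 0 : ℝ) →
      Ξ y = 0 := by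
    intro y hy hfy hl
    have hyw : y ^ (d (T - 1) - d 0) ≠ 0 := pow_ne_zero _ hy.ne'
    have key : Ξ y * y ^ (d (T - 1) - d 0)
        = (∑ j, y * (derivative (∑ i ∈ Finset.range (T + 1), C (c j i) * X ^ (d i) : ℝ[X])).eval y
          / (∑ i ∈ Finset.range (T + 1), C (c j i) * X ^ (d i) : ℝ[X]).eval y) - (m : ℝ) * (d 0 : ℝ) := by
      rw [hΞ]; simp only
      rw [Finset.sum_mul]
      have : ((m : ℝ) * (d 0 : ℝ)) = ∑ _j : Fin m, ((d 0 : ℕ) : ℝ) := by simp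
      rw [this, ← Finset.sum_sub_distrib]
      refine Finset.sum_congr rfl fun j _ => ?_
      have hfj := hfy j
      simp only [eval_sub, eval_mul, eval_X, eval_C]
      field_simp
    rw [hl, sub_self] at key
    exact (mul_eq_zero.1 key).resolve_right hyw
  have hΞ1 : Ξ w₁ = 0 := hlevel w₁ hw₁pos (hfree w₁ ⟨le_rfl, hw₁₂.le⟩) h1
  have hΞ2 : Ξ w₂ = 0 := hlevel w₂ (hw₁pos.trans hw₁₂) (hfree w₂ ⟨hw₁₂.le, le_rfl⟩) h2
  have hderiv : ∀ t ∈ Set.Icc w₁ w₂, ∃ D : ℝ, D < 0 ∧ HasDerivAt Ξ D t := by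
    intro t ht
    have ht0 : 0 < t := hw₁pos.trans_le ht.1
    choose D hD using fun j => hasDerivAt_coherentXi_neg T hT d hd (c j) (hcoh j) (htop j) ht0 (hfree t ht j)
    refine ⟨∑ j, D j, Finset.sum_neg (fun j _ => (hD j).1) ⟨⟨0, hm⟩, Finset.mem_univ _⟩, ?_⟩
    have := HasDerivAt.fun_sum (u := Finset.univ) (fun j _ => (hD j).2)
    rw [hΞ]; exact this
  have hcont : ContinuousOn Ξ (Set.Icc w₁ w₂) := fun t ht => by
    obtain ⟨D, _, hD⟩ := hderiv t ht
    exact hD.continuousAt.continuousWithinAt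
  obtain ⟨ξ, hξ, hξ'⟩ := exists_deriv_eq_zero hw₁₂ hcont (hΞ1.trans hΞ2.symm)
  obtain ⟨D, hDneg, hD⟩ := hderiv ξ ⟨hξ.1.le, hξ.2.le⟩
  rw [hD.deriv] at hξ'
  exact hDneg.ne hξ'

/-- **THE COHERENT ONE-ZERO SECTOR, EVERY FORMAT, SIGN-AWARE — line shape** (`3 ≤ K`, `d` strictly increasing, bottom coupling
`l₀ = 0`, every factor with `a j 0 · a j l > 0` for `l < K−1` and `a j 0 · a j (K−1) < 0`): `Z₊ ≤ m + 2`. [this file's theorem] -/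
theorem coherent_sector_classK_signed {m K : ℕ} (hK : 3 ≤ K) (d : Fin K → ℕ) (hd : StrictMono d) (a : Fin m → Fin K → ℝ)
    (hcoh : ∀ j (l : Fin K), (l : ℕ) < K - 1 → 0 < a j ⟨0, by omega⟩ * a j l)
    (htop : ∀ j, a j ⟨0, by omega⟩ * a j ⟨K - 1, by omega⟩ < 0) (c : ℝ) :
    ((C c * X ^ (m * d ⟨0, by omega⟩) + ∏ j, ∑ l, C (a j l) * X ^ (d l) : ℝ[X]).roots.toFinset.filter
      (fun t => 0 < t)).card ≤ m + 2 := by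
  classical
  obtain ⟨K', rfl⟩ : ∃ K', K = K' + 1 := ⟨K - 1, by omega⟩
  have hK' : 2 ≤ K' := by omega
  set dx : ℕ → ℕ := fun i => if h : i < K' + 1 then d ⟨i, h⟩ else d ⟨K', by omega⟩ + (i - K') with hdx
  set cx : Fin m → ℕ → ℝ := fun j i => if h : i < K' + 1 then a j ⟨i, h⟩ else 0 with hcx
  have hdx_in : ∀ i (h : i < K' + 1), dx i = d ⟨i, h⟩ := fun i h => by simp only [hdx]; exact dif_pos h
  have hdmono : StrictMono dx := by
    intro i j hij
    by_cases hj : j < K' + 1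
    · have hi : i < K' + 1 := by omega
      rw [hdx_in i hi, hdx_in j hj]
      exact hd (Fin.mk_lt_mk.mpr hij)
    · have ej : dx j = d ⟨K', by omega⟩ + (j - K') := by simp only [hdx]; exact dif_neg hj
      rw [ej]
      by_cases hi : i < K' + 1
      · rw [hdx_in i hi]
        have : d ⟨i, hi⟩ ≤ d ⟨K', by omega⟩ := hd.monotone (Fin.mk_le_mk.mpr (by omega))
        omega
      · have ei : dx i = d ⟨K', by omega⟩ + (i - K') := by simp only [hdx]; exact dif_neg hi
        rw [ei]
        omega
  have hfac : ∀ j, (∑ l, C (a j l) * X ^ (d l) : ℝ[X]) = ∑ i ∈ Finset.range (K' + 1), C (cx j i) * X ^ (dx i) := by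
    intro j
    rw [← Fin.sum_univ_eq_sum_range (fun i => C (cx j i) * X ^ (dx i)) (K' + 1)]
    refine Finset.sum_congr rfl (fun l _ => ?_)
    have hl : (l : ℕ) < K' + 1 := l.isLt
    simp only [hcx, hdx, dif_pos hl, Fin.eta]
  have hcoh' : ∀ j i, i < K' → 0 < cx j 0 * cx j i := by
    intro j i hi
    simp only [hcx, dif_pos (show 0 < K' + 1 by omega), dif_pos (show i < K' + 1 by omega)]
    exact hcoh j ⟨i, by omega⟩ (by simpa using hi)
  have htop' : ∀ j, cx j 0 * cx j K' < 0 := by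
    intro j
    simp only [hcx, dif_pos (show 0 < K' + 1 by omega), dif_pos (show K' < K' + 1 by omega)]
    have := htop j
    simpa using this
  rw [Finset.prod_congr rfl (fun j _ => hfac j)]
  have h0 : d ⟨0, by omega⟩ = dx 0 := by rw [hdx_in 0 (by omega)]
  rw [h0]
  exact coherentK_sector_pos_roots_signed K' hK' dx hdmono cx hcoh' htop' c

end ProductPlusOne

end Summit.ValiantsHypothesis.ValiantsHypothesis.Theorems.LacunarySymmetroidMatrixDescartes
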